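import Summits.CriticalPhenomena.PercolationContinuityZ3.Theorems.PercAnnulusCrossingIICTwoPointLower
import Summits.CriticalPhenomena.PercolationContinuityZ3.Theorems.PercAnnulusCrossingIICClusterAtomsContraction
import HarnessLib

/-!
# The IIC two-point function given the inner cluster: a quenched lower bound (lane RSW3, p1 gen 18)

builds on p205010 (kernel theorem, internal audit signed; external expert review pending) — NOT used in this file.

RSW3 lane (LANE 3 `prim-rsw3`), seat `prim-rsw3-p1` (gen 18).  Helper file (`--supports stmt-CriticalPhenomena-4575`);
no definitions, no sorries.  Memo `run/shared/lean/prim/rsw3/P1-QM.md` §31.7.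

Gen 17's spatial Markov identity at an atom `At_b(V,η)` of the inner cluster (`…IICClusterAtoms`: `P(E ∩ At ∩ A_n) = P(At)·P(E ∩ γ_n(V,Y))`
for `E` determined off the pairs at `V`) combined with gen 17's first-moment gluing (`real_openCrossing_inter_link_ge`: a far site hangs off the
arm of the cluster with probability `≳ π(64u)`) gives the QUENCHED form of gen 18 (3):

* **`mul_real_atom_inter_siteToBoundary_le`** — every `d`, `p`; `CU⁺_l`, single-level UAD, ratio bound; atom data `(V, F, K', η, Y)` at scale `b`,
  `u = sKb`, `z ∈ Λ(64u) ∖ Λ(32u)`, `n ≥ 64lu`: **`(c_U/2B_l)·π_p(64u)·P(At ∩ A_n) ≤ P(At ∩ {0 ↔ z in Λ(64lu)} ∩ A_n)`**;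
* **`mul_iicMeasure_real_atom_le`** — hence for every IIC measure `ν`: **`(c_U/2B_l)·π_p(64u)·ν(At) ≤ ν(At ∩ {0 ↔ z in Λ(64lu)})`** — WHATEVER the
  inner cluster of the IIC inside `Λ(b)` is, a site at scale `64sKb` is joined to the root (inside `Λ(64lsKb)`) with conditional probability
  `≥ (c_U/2B_l)·π(64sKb)`: the far two-point function of Kesten's IIC forgets the inner cluster (lower bound).
References: H. Kesten, PTRF 73 (1986) Thm. (8), §2 (2.16); D. Basu, A. Sapozhnikov, ECP 22 (2017).
-/

noncomputable section

namespace Summit.CriticalPhenomena.PercolationContinuityZ3.Theorems.Crossing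

open MeasureTheory Filter Topology Literature.Probability.Percolation Literature.Probability.LatticeModels
open Literature.Probability.Percolation.DCT16
open Summit.CriticalPhenomena.PercolationContinuityZ3.Theorems.SurfaceTension

variable {d : ℕ}

/-- The hang-off event `C_z = {z ↔ Y in Λ(M) ∖ V}` is determined off the pairs at `V` (indeed by the pairs of `Λ(M) ∖ V`), and measurable.
[folklore] -/
theorem determinedBy_openCrossing_singleton_compl {b M : ℕ} {V Y : Finset (Site d)} {K' : Finset (Sym2 (Site d))}
    (hK : ∀ e, e ∈ K' ↔ ∃ a ∈ V, ∃ b' ∈ box d (b + 1), e = s(a, b')) (z : Site d) :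
    DeterminedBy (openCrossing (↑(box d M \ V) : Set (Site d)) {z} ↑Y) (↑K' : Set (Sym2 (Site d)))ᶜ ∧
      MeasurableSet (openCrossing (↑(box d M \ V) : Set (Site d)) {z} ↑Y) := by
  classical
  have hset : openCrossing (↑(box d M \ V) : Set (Site d)) {z} ↑Y = ⋃ y ∈ Y, openConnIn (↑(box d M \ V) : Set (Site d)) z y := by
    ext ω
    simp only [mem_openCrossing_iff, Set.mem_singleton_iff, exists_eq_left, Finset.mem_coe, Set.mem_iUnion, exists_prop]
  have hdet : DeterminedBy (openCrossing (↑(box d M \ V) : Set (Site d)) {z} ↑Y) (↑((box d M \ V).sym2) : Set (Sym2 (Site d))) := by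
    rw [hset]
    exact DeterminedBy.iUnion fun y => DeterminedBy.iUnion fun _ => determinedBy_openConnIn _ z y (by rw [Finset.coe_sym2])
  exact ⟨hdet.mono (by rw [Finset.coe_sym2, Finset.coe_sdiff]; exact sym2_sdiff_subset_compl (n := M) hK), hdet.measurableSet_of_finset⟩

/-- **THE TWO-POINT FUNCTION GIVEN THE INNER CLUSTER, AT FINITE `n`** (every `d`, `p`; hypotheses of gen 17's `real_openCrossing_inter_link_ge`:
`CU⁺_l(c_U)`, `l ≥ 2`, annulus decay `α(m,N) ≤ ε` for `N ≥ K₀m` with `εB_l ≤ 1/2`, ratio bound `π(j) ≤ B_lπ(m)` for `j ≤ m ≤ 4(l+1)j`, `s ≥ 2`, `K ≥ 1`,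
`K₀ ≤ 16sK`, `b ≥ 1`, `u = sKb`, `64lu ≤ n`; atom data at scale `b`: `0 ∈ V ⊆ Λ(b)`, closed pairs `F`, pairs `K'` at `V`, pattern `η`, rim `Y`): for
`z ∈ Λ(64u) ∖ Λ(32u)`, **`(c_U/2B_l)·π_p(64u)·P(At ∩ A_n) ≤ P(At ∩ {0 ↔ z in Λ(64lu)} ∩ A_n)`** (Markov identity at the atom, twice; gluing off the
cluster; on the atom a site hanging off the rim is joined to the origin). [cite: Kesten1986, §2 (2.16) and Thm. (8)] -/
theorem mul_real_atom_inter_siteToBoundary_le (p : unitInterval) {l : ℕ} (hl : 2 ≤ l) {cU : ℝ} (hcU : 0 ≤ cU)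
    (hCU : ∀ a : ℕ, 1 ≤ a → ∀ E : Set (BondConfig (Site d)), IsUpperSet E → MeasurableSet E →
      cU * (bondPercolation (zdGraph d) p).real E ≤ (bondPercolation (zdGraph d) p).real (E ∩
        {ω : BondConfig (Site d) | ∀ t ∈ innerBoundary (zdGraph d) (box d a), ∀ s ∈ innerBoundary (zdGraph d) (box d (l * a)),
          ∀ t' ∈ innerBoundary (zdGraph d) (box d a), ∀ s' ∈ innerBoundary (zdGraph d) (box d (l * a)),
          ω ∈ openConnIn (↑((box d (l * a) \ box d a) ∪ innerBoundary (zdGraph d) (box d a)) : Set (Site d)) t s →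
          ω ∈ openConnIn (↑((box d (l * a) \ box d a) ∪ innerBoundary (zdGraph d) (box d a)) : Set (Site d)) t' s' →
          ω ∈ openConnIn (↑((box d (l * a) \ box d a) ∪ innerBoundary (zdGraph d) (box d a)) : Set (Site d)) s s'}))
    {ε Bl : ℝ} (hBl : 0 < Bl) (hεB : ε * Bl ≤ 1 / 2) {K₀ : ℕ}
    (hUAD : ∀ m : ℕ, 1 ≤ m → ∀ N : ℕ, K₀ * m ≤ N → (bondPercolation (zdGraph d) p).real (boxCrossing d m N) ≤ ε)
    (hRl : ∀ j m : ℕ, 1 ≤ j → j ≤ m → m ≤ 4 * (l + 1) * j → oneArmProb d p j ≤ Bl * oneArmProb d p m)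
    {s K b n : ℕ} (hs : 2 ≤ s) (hK : 1 ≤ K) (hK₀ : K₀ ≤ 16 * s * K) (hb : 1 ≤ b) (hn : l * (64 * (s * K * b)) ≤ n)
    {V : Finset (Site d)} (hVb : V ⊆ box d b) (h0 : (0 : Site d) ∈ V) {F K' η : Finset (Sym2 (Site d))}
    (hF : ∀ e, e ∈ F ↔ ∃ a ∈ V, ∃ b' ∈ box d b, b' ∉ V ∧ e = s(a, b'))
    (hKV : ∀ e, e ∈ K' ↔ ∃ a ∈ V, ∃ b' ∈ box d (b + 1), e = s(a, b')) {Y : Finset (Site d)}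
    (hY : ∀ b', b' ∈ Y ↔ b' ∈ box d (b + 1) ∧ b' ∉ box d b ∧ ∃ a ∈ V, s(a, b') ∈ η ∧ (zdGraph d).Adj a b')
    {z : Site d} (hz : z ∈ box d (64 * (s * K * b)) \ box d (32 * (s * K * b))) :
    cU / (2 * Bl) * oneArmProb d p (64 * (s * K * b)) *
        (bondPercolation (zdGraph d) p).real (({ω : BondConfig (Site d) | ∀ e ∈ F, e ∉ ω} ∩
        {ω | ∀ v ∈ V, ω ∈ openConnIn (↑V : Set (Site d)) 0 v} ∩ {ω | ∀ e ∈ K', e ∈ ω ↔ e ∈ η}) ∩ siteToBoundary d n) ≤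
      (bondPercolation (zdGraph d) p).real (({ω : BondConfig (Site d) | ∀ e ∈ F, e ∉ ω} ∩
        {ω | ∀ v ∈ V, ω ∈ openConnIn (↑V : Set (Site d)) 0 v} ∩ {ω | ∀ e ∈ K', e ∈ ω ↔ e ∈ η}) ∩
        openConnIn (↑(box d (l * (64 * (s * K * b)))) : Set (Site d)) 0 z ∩ siteToBoundary d n) := by
  set μ := bondPercolation (zdGraph d) p with hμ
  set At := ({ω : BondConfig (Site d) | ∀ e ∈ F, e ∉ ω} ∩
        {ω | ∀ v ∈ V, ω ∈ openConnIn (↑V : Set (Site d)) 0 v} ∩ {ω | ∀ e ∈ K', e ∈ ω ↔ e ∈ η}) with hAt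
  set Cz := openCrossing (↑(box d (l * (64 * (s * K * b))) \ V) : Set (Site d)) {z} ↑Y with hCz
  set γ := {ω : BondConfig (Site d) | ∃ y ∈ Y, ∃ t ∈ innerBoundary (zdGraph d) (box d n),
    ω ∈ openConnIn ((↑(box d n) : Set (Site d)) \ ↑V) y t} with hγ
  have hskb : b ≤ s * K * b := Nat.le_mul_of_pos_left b (Nat.mul_pos (by omega) (by omega))
  have hl64 : 2 * (64 * (s * K * b)) ≤ l * (64 * (s * K * b)) := Nat.mul_le_mul_right _ hl
  have hbM : b + 1 ≤ l * (64 * (s * K * b)) := by omega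
  have hbn : b + 1 < n := by omega
  have hY' : Y ⊆ box d (b + 1) := fun y hy => ((hY y).1 hy).1
  -- gen 17's gluing off the cluster
  have h7 := real_openCrossing_inter_link_ge (d := d) p hl hcU hCU hBl hεB hUAD hRl hs hK hK₀ hb hn hVb hY' hz
  -- the Markov identity at the atom, for `E = C_z` and `E = univ`
  obtain ⟨hCzdet, hCzm⟩ := determinedBy_openCrossing_singleton_compl (M := l * (64 * (s * K * b))) (V := V) (Y := Y) hKV z
  have hM1 := real_inter_atom_inter_siteToBoundary_eq p hbn hVb h0 hF hKV hY hCzm hCzdet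
  have hM0 := real_inter_atom_inter_siteToBoundary_eq p hbn hVb h0 hF hKV hY MeasurableSet.univ
    (Literature.Probability.Percolation.determinedBy_univ ((↑K' : Set (Sym2 (Site d)))ᶜ))
  rw [Set.univ_inter, Set.univ_inter] at hM0
  -- on the atom, `C_z ⊆ {0 ↔ z in Λ(64lu)}`
  have hsub : Cz ∩ At ∩ siteToBoundary d n ⊆ At ∩ openConnIn (↑(box d (l * (64 * (s * K * b)))) : Set (Site d)) 0 z ∩ siteToBoundary d n := by
    rintro ω ⟨⟨hωC, hωAt⟩, hωA⟩
    exact ⟨⟨hωAt, mem_openConnIn_box_of_mem_openCrossing_rim hbM hVb hKV hY hωAt hωC⟩, hωA⟩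
  calc cU / (2 * Bl) * oneArmProb d p (64 * (s * K * b)) * μ.real (At ∩ siteToBoundary d n)
      = μ.real At * (cU / (2 * Bl) * oneArmProb d p (64 * (s * K * b)) * μ.real γ) := by rw [hM0]; ring
    _ ≤ μ.real At * μ.real (Cz ∩ γ) := mul_le_mul_of_nonneg_left h7 measureReal_nonneg
    _ = μ.real (Cz ∩ At ∩ siteToBoundary d n) := hM1.symm
    _ ≤ _ := measureReal_mono hsub

/-- **THE FAR TWO-POINT FUNCTION OF KESTEN'S IIC FORGETS THE INNER CLUSTER (quenched lower bound)**: under the same hypotheses (every `d ≥ 1`,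
`p > 0`), for every finite measure `ν` with Kesten's IIC limit property, every atom `At_b(V,η)` of the inner cluster and every `z ∈ Λ(64u) ∖ Λ(32u)`:
**`(c_U/2B_l)·π_p(64u)·ν(At) ≤ ν(At ∩ {0 ↔ z in Λ(64lu)})`** — conditionally on the inner cluster being ANY `(V, η)`, a site at scale `64u` belongs to the
IIC (locally) with probability `≳ π(64u)`. [cite: Kesten1986, Thm. (8)] [cite: BasuSapozhnikov2017ECP, Thm. 1.1] -/
theorem mul_iicMeasure_real_atom_le (hd : 1 ≤ d) (p : unitInterval) (hp : 0 < (p : ℝ)) {l : ℕ} (hl : 2 ≤ l) {cU : ℝ} (hcU : 0 ≤ cU)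
    (hCU : ∀ a : ℕ, 1 ≤ a → ∀ E : Set (BondConfig (Site d)), IsUpperSet E → MeasurableSet E →
      cU * (bondPercolation (zdGraph d) p).real E ≤ (bondPercolation (zdGraph d) p).real (E ∩
        {ω : BondConfig (Site d) | ∀ t ∈ innerBoundary (zdGraph d) (box d a), ∀ s ∈ innerBoundary (zdGraph d) (box d (l * a)),
          ∀ t' ∈ innerBoundary (zdGraph d) (box d a), ∀ s' ∈ innerBoundary (zdGraph d) (box d (l * a)),
          ω ∈ openConnIn (↑((box d (l * a) \ box d a) ∪ innerBoundary (zdGraph d) (box d a)) : Set (Site d)) t s →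
          ω ∈ openConnIn (↑((box d (l * a) \ box d a) ∪ innerBoundary (zdGraph d) (box d a)) : Set (Site d)) t' s' →
          ω ∈ openConnIn (↑((box d (l * a) \ box d a) ∪ innerBoundary (zdGraph d) (box d a)) : Set (Site d)) s s'}))
    {ε Bl : ℝ} (hBl : 0 < Bl) (hεB : ε * Bl ≤ 1 / 2) {K₀ : ℕ}
    (hUAD : ∀ m : ℕ, 1 ≤ m → ∀ N : ℕ, K₀ * m ≤ N → (bondPercolation (zdGraph d) p).real (boxCrossing d m N) ≤ ε)
    (hRl : ∀ j m : ℕ, 1 ≤ j → j ≤ m → m ≤ 4 * (l + 1) * j → oneArmProb d p j ≤ Bl * oneArmProb d p m)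
    {ν : Measure (BondConfig (Site d))} [IsFiniteMeasure ν]
    (hν : ∀ (F : Finset (Sym2 (Site d))) (E : Set (BondConfig (Site d))), MeasurableSet E → DeterminedBy E ↑F →
      Tendsto (fun n : ℕ => (bondPercolation (zdGraph d) p).real (E ∩ siteToBoundary d n) / oneArmProb d p n)
        atTop (𝓝 (ν.real E)))
    {s K b : ℕ} (hs : 2 ≤ s) (hK : 1 ≤ K) (hK₀ : K₀ ≤ 16 * s * K) (hb : 1 ≤ b)
    {V : Finset (Site d)} (hVb : V ⊆ box d b) (h0 : (0 : Site d) ∈ V) {F K' η : Finset (Sym2 (Site d))}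
    (hF : ∀ e, e ∈ F ↔ ∃ a ∈ V, ∃ b' ∈ box d b, b' ∉ V ∧ e = s(a, b'))
    (hKV : ∀ e, e ∈ K' ↔ ∃ a ∈ V, ∃ b' ∈ box d (b + 1), e = s(a, b')) {Y : Finset (Site d)}
    (hY : ∀ b', b' ∈ Y ↔ b' ∈ box d (b + 1) ∧ b' ∉ box d b ∧ ∃ a ∈ V, s(a, b') ∈ η ∧ (zdGraph d).Adj a b')
    {z : Site d} (hz : z ∈ box d (64 * (s * K * b)) \ box d (32 * (s * K * b))) :
    cU / (2 * Bl) * oneArmProb d p (64 * (s * K * b)) * ν.real ({ω : BondConfig (Site d) | ∀ e ∈ F, e ∉ ω} ∩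
        {ω | ∀ v ∈ V, ω ∈ openConnIn (↑V : Set (Site d)) 0 v} ∩ {ω | ∀ e ∈ K', e ∈ ω ↔ e ∈ η}) ≤
      ν.real (({ω : BondConfig (Site d) | ∀ e ∈ F, e ∉ ω} ∩
        {ω | ∀ v ∈ V, ω ∈ openConnIn (↑V : Set (Site d)) 0 v} ∩ {ω | ∀ e ∈ K', e ∈ ω ↔ e ∈ η}) ∩ openConnIn (↑(box d (l * (64 * (s * K * b)))) : Set (Site d)) 0 z) := by
  set At := ({ω : BondConfig (Site d) | ∀ e ∈ F, e ∉ ω} ∩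
        {ω | ∀ v ∈ V, ω ∈ openConnIn (↑V : Set (Site d)) 0 v} ∩ {ω | ∀ e ∈ K', e ∈ ω ↔ e ∈ η}) with hAt
  have hAtloc : IsLocalEvent At := ⟨K', determinedBy_atom hVb η hF hKV⟩
  have hCloc : IsLocalEvent (openConnIn (↑(box d (l * (64 * (s * K * b)))) : Set (Site d)) (0 : Site d) z) :=
    ⟨(box d (l * (64 * (s * K * b)))).sym2, determinedBy_openConnIn _ 0 z (by rw [Finset.coe_sym2])⟩
  have hT1 := tendsto_iicMeasure_of_isLocalEvent p hν hAtloc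
  have hT2 := tendsto_iicMeasure_of_isLocalEvent p hν (hAtloc.inter hCloc)
  refine le_of_tendsto_of_tendsto (hT1.const_mul (cU / (2 * Bl) * oneArmProb d p (64 * (s * K * b)))) hT2
    (eventually_atTop.2 ⟨l * (64 * (s * K * b)), fun n hn => ?_⟩)
  have h := mul_real_atom_inter_siteToBoundary_le p hl hcU hCU hBl hεB hUAD hRl hs hK hK₀ hb hn hVb h0 hF hKV hY hz
  show cU / (2 * Bl) * oneArmProb d p (64 * (s * K * b)) * ((bondPercolation (zdGraph d) p).real (At ∩ siteToBoundary d n) / oneArmProb d p n) ≤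
    (bondPercolation (zdGraph d) p).real (At ∩ openConnIn (↑(box d (l * (64 * (s * K * b)))) : Set (Site d)) 0 z ∩ siteToBoundary d n) /
      oneArmProb d p n
  rw [← mul_div_assoc, div_le_div_iff_of_pos_right (oneArmProb_pos hd p hp n)]
  exact h

end Summit.CriticalPhenomena.PercolationContinuityZ3.Theorems.Crossing

end
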